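import Literature.Barriers.CriticalPhenomena.RigorousRGSmallParameterScalingFunctionRegularity
import Literature.Barriers.CriticalPhenomena.RigorousRGSmallParameterCovarianceParseval
import Literature.Barriers.CriticalPhenomena.RigorousRGSmallParameterRiemannSum
import HarnessLib

/-!
# `RigorousRGSmallParameter` (Slade, Theorem 1.4.1): the asymptotics (10.45) of the pairings
# `(C_k, C_{k+l})` at `m² = 0` and the positivity `⟨c₀, c_l⟩ ≥ 0`

Ninth file of the §10.3–§10.4 layer; the core of the proof of Lemma 5.2.2. G. Slade, *Critical
exponents for long-range `O(n)` models below the upper critical dimension*, Commun. Math. Phys.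
**358** (2018), §10.4, proof of Lemma 5.2.2: "With `c₀(x,m²)` from (10.40), let `c₀(x) = c₀(x,0)`.
Let `c_k(x) = L^{-(d-α)k}c₀(L^{-k}x)` and `p = d-α+1`. By Lemma 10.3.1, (10.44) `C_{k;0,x} = c_k(x) +
O(L^{-pk})`. We write `⟨f,g⟩ = ∫_{ℝ^d}fg dx`. We claim that (10.45) `(C_k,C_{k+l}) = L^{εk}⟨c₀,c_l⟩ +
O(L^{εk}L^{-k}L^{-(d-α)l})`. To see this, let `R_{k,x} = C_{k;0,x} - c_k(x)`. Then (10.46)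
`(C_k,C_{k+l}) = (c_k,c_{k+l}) + (c_k,R_{k+l}) + (c_{k+l},R_k) + (R_k,R_{k+l})`. Riemann sum
approximation gives … `= O(L^{εk}L^{-k}L^{-(d-α)l})`. For the remaining terms, we use the fact that
the supports of `C_k` and `R_k` are `O(L^{dk})` … and (10.45) follows. … it follows from the
Parseval equality, together with the nonnegativity of the Fourier transform `ĉ₀`, that each inner
product … is nonnegative".

Here `(C_k,C_{k+l}) = Σ_{|x|₁<½L^k}C_{k;0,x}(0)C_{k+l;0,x}(0)` (the sum over the range of `C_k`),
`ε = 2α-d`, and `⟨c₀,c_l⟩ = (L^l)^{α-d}I_l` with `I_l := ∫_{ℝ^d}c₀(y,0)c₀(y/L^l,0)dy` (`FRD.innerC0`).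
The inputs are Lemma 10.3.1 (`FRD.Slade2017_lem1031`, `m² = 0`), the Lipschitz bound, boundedness
and compact support of `c₀` (`RigorousRGSmallParameterScalingFunctionRegularity`), the Riemann-sum
estimate (`RigorousRGSmallParameterRiemannSum`), and — for the positivity, established on the lattice —
`(C_k,C_m) ≥ 0` (`RigorousRGSmallParameterCovarianceParseval`): `I_l = lim_k
(L^k)^{d-2α}(L^l)^{d-α}(C_k,C_{k+l}) ≥ 0`.

## What this file proves (everything; one definition `FRD.innerC0`, no named fact)

* `FRD.cZero_eq_zero_of_half_le`, `FRD.cZero_eq_zero_of_norm_gt` (support of `c₀(·,A)` in the closed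
  `ℓ¹`-ball `Σ|y_i| ≤ ½`, hence in `‖y‖_∞ ≤ ½`).
* `FRD.innerC0` (`I_l`), `FRD.pairIntegrand_lipschitz_support`, `FRD.abs_innerC0_le` (`|I_l| ≤ K`
  uniformly in `l` — "Since `c₀` has support of order 1, `|⟨c₀,c_k⟩| ≤ O(L^{-(d-α)k})`").
* **`FRD.sum_fracCov_mul_fracCov_asymp`** — **(10.45) at `m² = 0`, PROVED**:
  `|(C_k,C_{k+l}) - (L^k)^{2α-d}(L^l)^{α-d}I_l| ≤ C(L^k)^{2α-d}(L^l)^{α-d}(L^k)⁻¹` for `k ≥ 2`, `l ≥ 0`.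
* **`FRD.innerC0_nonneg`** — `I_l ≥ 0`, i.e. `⟨c₀,c_l⟩ ≥ 0`, for every `l`.
-/

noncomputable section

namespace Literature.Barriers.CriticalPhenomena

open _root_.MeasureTheory Set Filter
open scoped _root_.Topology Real

namespace LongRangePhi4

namespace FRD

open Literature.Probability.LatticeModels

variable {d : ℕ}

/-! ### Support of `c₀(·,A)` in the closed `ℓ¹`-ball and in the sup-norm ball -/

/-- `c₀(y,A) = 0` as soon as `Σ_i|y_i| ≥ ½` (the boundary case by Lipschitz continuity).
[cite: Slade2017, §10.3 ("with compact support in ℝ^d")] -/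
theorem cZero_eq_zero_of_half_le (hd : 1 ≤ d) {α : ℝ} (hα0 : 0 < α) (hα2 : α < 2) {L : ℝ}
    (hL : 2 ≤ L) {y : Fin d → ℝ} (hy : 1 / 2 ≤ ∑ i, |y i|) (A : ℝ) : cZero d L α y A = 0 := by
  rcases hy.lt_or_eq with hlt | heq
  · exact cZero_eq_zero_of_half_lt hd hα0 hα2 hL hlt A
  · obtain ⟨Lc, hLc, hlip⟩ := abs_cZero_sub_le hd hα0 hα2 (by linarith : (1 : ℝ) ≤ L)
    -- `c₀((1+ε)y) = 0` for every `ε > 0`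
    have hε : ∀ ε : ℝ, 0 < ε → |cZero d L α y A| ≤ Lc * (ε * ‖y‖) := by
      intro ε hε
      have h1 : 1 / 2 < ∑ i, |((1 + ε) • y) i| := by
        have e : ∑ i, |((1 + ε) • y) i| = (1 + ε) * ∑ i, |y i| := by
          rw [Finset.mul_sum]
          refine Finset.sum_congr rfl fun i _ => ?_
          rw [Pi.smul_apply, smul_eq_mul, abs_mul, abs_of_pos (by linarith)]
        rw [e, ← heq]
        nlinarith
      have h2 := cZero_eq_zero_of_half_lt hd hα0 hα2 hL h1 A
      have h3 := hlip A y ((1 + ε) • y)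
      rw [h2, sub_zero] at h3
      have e2 : y - (1 + ε) • y = (-ε) • y := by
        rw [sub_eq_add_neg, ← neg_smul, show y + -(1 + ε) • y = (1 : ℝ) • y + -(1 + ε) • y by rw [one_smul],
          ← add_smul]
        congr 1; ring
      rw [e2, norm_smul, Real.norm_eq_abs, abs_neg, abs_of_pos hε] at h3
      exact h3
    by_contra hne
    have hpos : 0 < |cZero d L α y A| := abs_pos.2 hne
    have hy0 : 0 < ‖y‖ := by
      by_contra h0
      have : ‖y‖ = 0 := le_antisymm (le_of_not_gt h0) (norm_nonneg _)
      rw [norm_eq_zero] at this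
      subst this
      simp at heq
    have := hε (|cZero d L α y A| / (2 * Lc * ‖y‖)) (by positivity)
    have e : Lc * (|cZero d L α y A| / (2 * Lc * ‖y‖) * ‖y‖) = |cZero d L α y A| / 2 := by
      field_simp
    rw [e] at this
    linarith

/-- `c₀(y,A) = 0` for `‖y‖_∞ > ½` (`d ≥ 1`: `Σ|y_i| ≥ ‖y‖_∞`). [cite: Slade2017, §10.3] -/
theorem cZero_eq_zero_of_norm_gt (hd : 1 ≤ d) {α : ℝ} (hα0 : 0 < α) (hα2 : α < 2) {L : ℝ}
    (hL : 2 ≤ L) {y : Fin d → ℝ} (hy : 1 / 2 < ‖y‖) (A : ℝ) : cZero d L α y A = 0 := by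
  refine cZero_eq_zero_of_half_lt hd hα0 hα2 hL (lt_of_lt_of_le hy ?_) A
  refine (pi_norm_le_iff_of_nonneg (Finset.sum_nonneg fun i _ => abs_nonneg (y i))).2 fun i => ?_
  rw [Real.norm_eq_abs]
  exact Finset.single_le_sum (f := fun j => |y j|) (fun j _ => abs_nonneg _) (Finset.mem_univ i)

/-! ### The continuum pairing `⟨c₀, c₀(·/L^l)⟩` -/

/-- **`I_l = ∫_{ℝ^d} c₀(y,0) c₀(y/L^l,0) dy`**, so that Slade's `⟨c₀,c_l⟩ = L^{-(d-α)l}I_l`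
(`c_l(x) = L^{-(d-α)l}c₀(L^{-l}x)`). [cite: Slade2017, Lemma 5.2.2 (proof, §10.4: c_k(x) = L^{-(d-α)k}c₀(L^{-k}x), ⟨f,g⟩ = ∫fg)] -/
def innerC0 (d : ℕ) (L α : ℝ) (l : ℕ) : ℝ :=
  ∫ y : Fin d → ℝ, cZero d L α y 0 * cZero d L α (fun i => y i / L ^ l) 0

/-- The integrand `F_l(y) = c₀(y,0)c₀(y/L^l,0)` is Lipschitz with constant `2C₀Lc` and vanishes for
`‖y‖_∞ > ½`. [cite: Slade2017, §10.4 (‖∇(c₀c_l)‖_∞)] -/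
theorem pairIntegrand_lipschitz_support (hd : 1 ≤ d) {α : ℝ} (hα0 : 0 < α) (hα2 : α < 2) {L : ℝ}
    (hL : 2 ≤ L) :
    ∃ K : ℝ, 0 < K ∧ ∀ l : ℕ,
      (∀ y y' : Fin d → ℝ, |cZero d L α y 0 * cZero d L α (fun i => y i / L ^ l) 0 -
          cZero d L α y' 0 * cZero d L α (fun i => y' i / L ^ l) 0| ≤ K * ‖y - y'‖) ∧
      (∀ y : Fin d → ℝ, 1 / 2 < ‖y‖ → cZero d L α y 0 * cZero d L α (fun i => y i / L ^ l) 0 = 0) ∧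
      (∀ y : Fin d → ℝ, |cZero d L α y 0 * cZero d L α (fun i => y i / L ^ l) 0| ≤ K) := by
  have hL1 : (1 : ℝ) ≤ L := by linarith
  have hL0 : (0 : ℝ) < L := by linarith
  obtain ⟨C₀, hC₀, hb⟩ := abs_cZero_le hd hα0 hα2 hL1
  obtain ⟨Lc, hLc, hlip⟩ := abs_cZero_sub_le hd hα0 hα2 hL1
  refine ⟨2 * C₀ * Lc + C₀ * C₀, by positivity, fun l => ⟨fun y y' => ?_, fun y hy => ?_, fun y => ?_⟩⟩
  · have hΛ : (1 : ℝ) ≤ L ^ l := one_le_pow₀ hL1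
    have hΛ0 : (0 : ℝ) < L ^ l := by positivity
    have e : cZero d L α y 0 * cZero d L α (fun i => y i / L ^ l) 0 -
        cZero d L α y' 0 * cZero d L α (fun i => y' i / L ^ l) 0 =
        (cZero d L α y 0 - cZero d L α y' 0) * cZero d L α (fun i => y i / L ^ l) 0 +
          cZero d L α y' 0 * (cZero d L α (fun i => y i / L ^ l) 0 - cZero d L α (fun i => y' i / L ^ l) 0) := by
      ring
    rw [e]
    have h1 := hlip 0 y y'
    have h2 := hlip 0 (fun i => y i / L ^ l) (fun i => y' i / L ^ l)
    have hn : ‖(fun i => y i / L ^ l) - (fun i => y' i / L ^ l)‖ ≤ ‖y - y'‖ := by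
      have e2 : (fun i => y i / L ^ l) - (fun i => y' i / L ^ l) = (L ^ l)⁻¹ • (y - y') := by
        funext i; simp only [Pi.sub_apply, Pi.smul_apply, smul_eq_mul]; ring
      rw [e2, norm_smul, Real.norm_eq_abs, abs_of_pos (by positivity)]
      exact mul_le_of_le_one_left (norm_nonneg _) (inv_le_one_of_one_le₀ hΛ)
    calc |(cZero d L α y 0 - cZero d L α y' 0) * cZero d L α (fun i => y i / L ^ l) 0 +
          cZero d L α y' 0 * (cZero d L α (fun i => y i / L ^ l) 0 - cZero d L α (fun i => y' i / L ^ l) 0)|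
        ≤ |cZero d L α y 0 - cZero d L α y' 0| * |cZero d L α (fun i => y i / L ^ l) 0| +
          |cZero d L α y' 0| * |cZero d L α (fun i => y i / L ^ l) 0 - cZero d L α (fun i => y' i / L ^ l) 0| := by
          refine (abs_add_le _ _).trans ?_
          rw [abs_mul, abs_mul]
      _ ≤ Lc * ‖y - y'‖ * C₀ + C₀ * (Lc * ‖y - y'‖) := by
          gcongr
          · exact hb _ _
          · exact hb _ _
          · exact h2.trans (mul_le_mul_of_nonneg_left hn hLc.le)
      _ = 2 * C₀ * Lc * ‖y - y'‖ := by ring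
      _ ≤ (2 * C₀ * Lc + C₀ * C₀) * ‖y - y'‖ := by
          have := norm_nonneg (y - y'); nlinarith
  · rw [cZero_eq_zero_of_norm_gt hd hα0 hα2 hL hy 0, zero_mul]
  · rw [abs_mul]
    calc |cZero d L α y 0| * |cZero d L α (fun i => y i / L ^ l) 0| ≤ C₀ * C₀ :=
          mul_le_mul (hb _ _) (hb _ _) (abs_nonneg _) hC₀.le
      _ ≤ 2 * C₀ * Lc + C₀ * C₀ := by nlinarith

/-- **`|I_l| ≤ K`** (the integrand is bounded by `K` and supported in the unit cube `‖y‖_∞ ≤ ½`).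
[cite: Slade2017, §10.4 ("Since c₀ has support of order 1, |⟨c₀,c_k⟩| ≤ O(L^{-(d-α)k})")] -/
theorem abs_innerC0_le (hd : 1 ≤ d) {α : ℝ} (hα0 : 0 < α) (hα2 : α < 2) {L : ℝ} (hL : 2 ≤ L) :
    ∃ K : ℝ, 0 < K ∧ ∀ l : ℕ, |innerC0 d L α l| ≤ K := by
  obtain ⟨K, hK, hF⟩ := pairIntegrand_lipschitz_support hd hα0 hα2 hL
  refine ⟨K, hK, fun l => ?_⟩
  obtain ⟨hlipF, hsuppF, hbF⟩ := hF l
  unfold innerC0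
  have hsupp : Function.support (fun y : Fin d → ℝ => cZero d L α y 0 * cZero d L α (fun i => y i / L ^ l) 0) ⊆
      Metric.closedBall (0 : Fin d → ℝ) (1 / 2) := by
    intro y hy
    rw [Metric.mem_closedBall, dist_zero_right]
    by_contra h
    exact hy (hsuppF y (lt_of_not_ge h))
  rw [← setIntegral_eq_integral_of_forall_compl_eq_zero (s := Metric.closedBall (0 : Fin d → ℝ) (1 / 2))
    fun y hy => Function.notMem_support.1 fun h => hy (hsupp h)]
  have hfin : volume (Metric.closedBall (0 : Fin d → ℝ) (1 / 2)) < ⊤ := by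
    rw [Real.volume_pi_closedBall _ (by norm_num)]; exact ENNReal.ofReal_lt_top
  have h := norm_setIntegral_le_of_norm_le_const hfin (C := K) fun y _ => by
    rw [Real.norm_eq_abs]; exact hbF y
  rw [Real.norm_eq_abs] at h
  refine h.trans ?_
  rw [Measure.real, Real.volume_pi_closedBall _ (by norm_num), ENNReal.toReal_ofReal (by positivity)]
  norm_num

/-! ### (10.45): `(C_k, C_{k+l}) = L^{εk}⟨c₀,c_l⟩ + O(L^{εk}L^{-k}L^{-(d-α)l})` at `m² = 0` -/

/-- **Slade (10.45) at `m² = 0`, PROVED**: for `d ≥ 1`, `α ∈ (0,2)`, `L ≥ 2` there is `C` such that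
for all `k ≥ 2`, `l ≥ 0`,
`|Σ_x C_{k;0,x}C_{k+l;0,x} - (L^k)^{2α-d}(L^l)^{α-d}I_l| ≤ C(L^k)^{2α-d}(L^l)^{α-d}(L^k)⁻¹`
(`ε = 2α - d`, `⟨c₀,c_l⟩ = (L^l)^{α-d}I_l`): "We claim that (10.45)
`(C_k,C_{k+l}) = L^{εk}⟨c₀,c_l⟩ + O(L^{εk}L^{-k}L^{-(d-α)l})`. To see this, let `R_{k,x} = C_{k;0,x} -
c_k(x)`. Then `(C_k,C_{k+l}) = (c_k,c_{k+l}) + (c_k,R_{k+l}) + (c_{k+l},R_k) + (R_k,R_{k+l})`.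
Riemann sum approximation gives … `O(L^{εk}L^{-k}L^{-(d-α)l})`. For the remaining terms, we use the
fact that the supports of `C_k` and `R_k` are `O(L^{dk})` to see that `(c_k,R_{k+l}) ≤
O(L^{dk})‖c_k‖_∞‖R_{k+l}‖_∞ ≤ O(L^{εk}L^{-k}L^{-pl})`, `(c_{k+l},R_k) ≤ … ≤ O(L^{εk}L^{-k}L^{-(d-α)l})`,
`(R_k,R_{k+l}) ≤ … ≤ O(L^{εk}L^{-2k}L^{-pl})`, and (10.45) follows."
[cite: Slade2017, Lemma 5.2.2 (proof, §10.4, displays (10.44)–(10.46))] -/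
theorem sum_fracCov_mul_fracCov_asymp (hd : 1 ≤ d) {α : ℝ} (hα0 : 0 < α) (hα2 : α < 2) {L : ℝ}
    (hL : 2 ≤ L) :
    ∃ C : ℝ, 0 < C ∧ ∀ k : ℕ, 2 ≤ k → ∀ l : ℕ,
      |∑ x ∈ PT.ball (L ^ k / 2), fracCov d L α 0 k x * fracCov d L α 0 (k + l) x -
        (L ^ k) ^ (2 * α - d) * (L ^ l) ^ (α - d) * innerC0 d L α l| ≤
        C * (L ^ k) ^ (2 * α - d) * (L ^ l) ^ (α - d) * (L ^ k)⁻¹ := by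
  have hd' : (1 : ℝ) ≤ d := by exact_mod_cast hd
  have hL1 : (1 : ℝ) ≤ L := by linarith
  have hL0 : (0 : ℝ) < L := by linarith
  obtain ⟨C₁, hC₁, h31⟩ := Slade2017_lem1031 hd hα0 hα2 hL
  obtain ⟨C₀, hC₀, hb⟩ := abs_cZero_le hd hα0 hα2 hL1
  obtain ⟨K, hK, hF⟩ := pairIntegrand_lipschitz_support hd hα0 hα2 hL
  -- the constant
  refine ⟨K * 4 ^ d + 2 ^ d * (2 * C₀ * C₁ + C₁ * C₁) + 1, by positivity, fun k hk l => ?_⟩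
  obtain ⟨hlipF, hsuppF, hbF⟩ := hF l
  set Λ : ℝ := L ^ k with hΛ
  set Λ' : ℝ := L ^ (k + l) with hΛ'
  have hΛ0 : 0 < Λ := pow_pos hL0 k
  have hΛ1 : 1 ≤ Λ := one_le_pow₀ hL1
  have hΛ'eq : Λ' = Λ * L ^ l := by rw [hΛ', hΛ, pow_add]
  have hLl : (1 : ℝ) ≤ L ^ l := one_le_pow₀ hL1
  have hΛ'0 : 0 < Λ' := pow_pos hL0 _
  have hΛΛ' : Λ ≤ Λ' := by rw [hΛ'eq]; exact le_mul_of_one_le_right hΛ0.le hLl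
  -- the errors `E_j(x) = Λ_j^{d-α}C_j(x) - c₀(x/Λ_j)`
  set c : Site d → ℝ := fun x => cZero d L α (fun i => (x i : ℝ) / Λ) 0 with hc
  set c' : Site d → ℝ := fun x => cZero d L α (fun i => (x i : ℝ) / Λ') 0 with hc'
  set E : Site d → ℝ := fun x => Λ ^ ((d : ℝ) - α) * fracCov d L α 0 k x - c x with hE
  set E' : Site d → ℝ := fun x => Λ' ^ ((d : ℝ) - α) * fracCov d L α 0 (k + l) x - c' x with hE'
  have hpk : 0 < Λ ^ (α - d) := Real.rpow_pos_of_pos hΛ0 _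
  have hpk' : 0 < Λ' ^ (α - d) := Real.rpow_pos_of_pos hΛ'0 _
  have hinv : ∀ {z : ℝ}, 0 < z → z ^ ((d : ℝ) - α) * z ^ (α - d) = 1 := fun hz => by
    rw [← Real.rpow_add hz]; simp
  have hCk : ∀ x, fracCov d L α 0 k x = Λ ^ (α - d) * (c x + E x) := by
    intro x
    simp only [hE]
    have := hinv hΛ0
    calc fracCov d L α 0 k x = (Λ ^ ((d : ℝ) - α) * Λ ^ (α - d)) * fracCov d L α 0 k x := by rw [this, one_mul]
      _ = _ := by ring
  have hCm : ∀ x, fracCov d L α 0 (k + l) x = Λ' ^ (α - d) * (c' x + E' x) := by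
    intro x
    simp only [hE']
    have := hinv hΛ'0
    calc fracCov d L α 0 (k + l) x = (Λ' ^ ((d : ℝ) - α) * Λ' ^ (α - d)) * fracCov d L α 0 (k + l) x := by
          rw [this, one_mul]
      _ = _ := by ring
  have hEb : ∀ x, |E x| ≤ C₁ * Λ⁻¹ := by
    intro x
    have h := h31 k hk 0 x
    rw [← hΛ, zero_mul] at h
    have hp : 0 < Λ ^ ((d : ℝ) - α) := Real.rpow_pos_of_pos hΛ0 _
    have e : E x = Λ ^ ((d : ℝ) - α) * (fracCov d L α 0 k x - Λ ^ (α - d) * c x) := by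
      simp only [hE, hc]
      have := hinv hΛ0
      calc Λ ^ ((d : ℝ) - α) * fracCov d L α 0 k x - cZero d L α (fun i => (x i : ℝ) / Λ) 0
          = Λ ^ ((d : ℝ) - α) * fracCov d L α 0 k x -
            (Λ ^ ((d : ℝ) - α) * Λ ^ (α - d)) * cZero d L α (fun i => (x i : ℝ) / Λ) 0 := by rw [this, one_mul]
        _ = _ := by ring
    rw [e, abs_mul, abs_of_pos hp]
    calc Λ ^ ((d : ℝ) - α) * |fracCov d L α 0 k x - Λ ^ (α - d) * c x|
        ≤ Λ ^ ((d : ℝ) - α) * (C₁ * Λ ^ (α - d) * Λ⁻¹) := mul_le_mul_of_nonneg_left h hp.le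
      _ = C₁ * Λ⁻¹ * (Λ ^ ((d : ℝ) - α) * Λ ^ (α - d)) := by ring
      _ = C₁ * Λ⁻¹ := by rw [hinv hΛ0, mul_one]
  have hE'b : ∀ x, |E' x| ≤ C₁ * Λ⁻¹ := by
    intro x
    have h := h31 (k + l) (by omega) 0 x
    rw [← hΛ', zero_mul] at h
    have hp : 0 < Λ' ^ ((d : ℝ) - α) := Real.rpow_pos_of_pos hΛ'0 _
    have e : E' x = Λ' ^ ((d : ℝ) - α) * (fracCov d L α 0 (k + l) x - Λ' ^ (α - d) * c' x) := by
      simp only [hE', hc']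
      have := hinv hΛ'0
      calc Λ' ^ ((d : ℝ) - α) * fracCov d L α 0 (k + l) x - cZero d L α (fun i => (x i : ℝ) / Λ') 0
          = Λ' ^ ((d : ℝ) - α) * fracCov d L α 0 (k + l) x -
            (Λ' ^ ((d : ℝ) - α) * Λ' ^ (α - d)) * cZero d L α (fun i => (x i : ℝ) / Λ') 0 := by
              rw [this, one_mul]
        _ = _ := by ring
    rw [e, abs_mul, abs_of_pos hp]
    calc Λ' ^ ((d : ℝ) - α) * |fracCov d L α 0 (k + l) x - Λ' ^ (α - d) * c' x|
        ≤ Λ' ^ ((d : ℝ) - α) * (C₁ * Λ' ^ (α - d) * Λ'⁻¹) := mul_le_mul_of_nonneg_left h hp.le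
      _ = C₁ * Λ'⁻¹ * (Λ' ^ ((d : ℝ) - α) * Λ' ^ (α - d)) := by ring
      _ = C₁ * Λ'⁻¹ := by rw [hinv hΛ'0, mul_one]
      _ ≤ C₁ * Λ⁻¹ := mul_le_mul_of_nonneg_left (inv_anti₀ hΛ0 hΛΛ') hC₁.le
  have hcb : ∀ x, |c x| ≤ C₀ := fun x => hb _ _
  have hc'b : ∀ x, |c' x| ≤ C₀ := fun x => hb _ _
  -- the box and its cardinality
  set B : Finset (Site d) := PT.ball (Λ / 2) with hB
  have hcard : ((B.card : ℕ) : ℝ) ≤ (2 * Λ) ^ d := by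
    refine (PT.card_ball_le (by positivity)).trans ?_
    apply pow_le_pow_left₀ (by positivity)
    linarith
  -- main term: the Riemann sum of `F_l`
  set F : (Fin d → ℝ) → ℝ := fun y => cZero d L α y 0 * cZero d L α (fun i => y i / L ^ l) 0 with hFdef
  have hcc' : ∀ x, c x * c' x = F (fun i => (x i : ℝ) / Λ) := by
    intro x
    simp only [hc, hc', hFdef, hΛ'eq]
    congr 2
    funext i
    field_simp
  obtain ⟨-, hR⟩ := abs_riemannSum_sub_integral_le hK.le (by norm_num : (0 : ℝ) ≤ 1 / 2) hlipF hsuppF hΛ1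
  -- the Riemann sum over `box(Λ/2+1)` equals the sum over the ball `B`
  have hsumF : ∑ x ∈ PT.box (Λ * (1 / 2) + 1), F (fun i => (x i : ℝ) / Λ) = ∑ x ∈ B, c x * c' x := by
    simp_rw [hcc']
    symm
    refine Finset.sum_subset (fun x hx => ?_) (fun x _ hx => ?_)
    · have hx' := PT.mem_ball.1 hx
      exact PT.mem_box_of_lt (by linarith)
    · -- off the ball `c₀(x/Λ) = 0`
      rw [hB, PT.mem_ball, not_lt] at hx
      simp only [hFdef]
      rw [cZero_eq_zero_of_half_le hd hα0 hα2 hL ?_ 0, zero_mul]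
      have e : ∑ i, |((x i : ℤ) : ℝ) / Λ| = ((∑ i, (x i).natAbs : ℕ) : ℝ) / Λ := by
        push_cast
        rw [Finset.sum_div]
        refine Finset.sum_congr rfl fun i _ => ?_
        rw [abs_div, abs_of_pos hΛ0, ← Int.cast_natCast, Int.natCast_natAbs, Int.cast_abs]
      rw [e, le_div_iff₀ hΛ0]
      linarith
  rw [hsumF] at hR
  -- hR : |(Λ^d)⁻¹ * Σ_B c c' - I_l| ≤ K 4^d Λ⁻¹  (with (2·(1/2)+3)^d = 4^d)
  have hR' : |∑ x ∈ B, c x * c' x - Λ ^ d * innerC0 d L α l| ≤ K * 4 ^ d * Λ⁻¹ * Λ ^ d := by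
    have hΛd : 0 < Λ ^ d := pow_pos hΛ0 d
    have e : ∑ x ∈ B, c x * c' x - Λ ^ d * innerC0 d L α l =
        Λ ^ d * ((Λ ^ d)⁻¹ * ∑ x ∈ B, c x * c' x - innerC0 d L α l) := by
      unfold innerC0; field_simp
    rw [e, abs_mul, abs_of_pos hΛd, mul_comm]
    refine mul_le_mul_of_nonneg_right (hR.trans (le_of_eq ?_)) hΛd.le
    norm_num
  -- the three cross terms
  have hX1 : |∑ x ∈ B, c x * E' x| ≤ (2 * Λ) ^ d * (C₀ * (C₁ * Λ⁻¹)) := by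
    calc |∑ x ∈ B, c x * E' x| ≤ ∑ x ∈ B, |c x * E' x| := Finset.abs_sum_le_sum_abs _ _
      _ ≤ ∑ _x ∈ B, C₀ * (C₁ * Λ⁻¹) := Finset.sum_le_sum fun x _ => by
          rw [abs_mul]; exact mul_le_mul (hcb x) (hE'b x) (abs_nonneg _) hC₀.le
      _ = B.card * (C₀ * (C₁ * Λ⁻¹)) := by rw [Finset.sum_const, nsmul_eq_mul]
      _ ≤ (2 * Λ) ^ d * (C₀ * (C₁ * Λ⁻¹)) := mul_le_mul_of_nonneg_right hcard (by positivity)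
  have hX2 : |∑ x ∈ B, E x * c' x| ≤ (2 * Λ) ^ d * (C₁ * Λ⁻¹ * C₀) := by
    calc |∑ x ∈ B, E x * c' x| ≤ ∑ x ∈ B, |E x * c' x| := Finset.abs_sum_le_sum_abs _ _
      _ ≤ ∑ _x ∈ B, C₁ * Λ⁻¹ * C₀ := Finset.sum_le_sum fun x _ => by
          rw [abs_mul]; exact mul_le_mul (hEb x) (hc'b x) (abs_nonneg _) (by positivity)
      _ = B.card * (C₁ * Λ⁻¹ * C₀) := by rw [Finset.sum_const, nsmul_eq_mul]
      _ ≤ (2 * Λ) ^ d * (C₁ * Λ⁻¹ * C₀) := mul_le_mul_of_nonneg_right hcard (by positivity)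
  have hX3 : |∑ x ∈ B, E x * E' x| ≤ (2 * Λ) ^ d * (C₁ * Λ⁻¹ * (C₁ * Λ⁻¹)) := by
    calc |∑ x ∈ B, E x * E' x| ≤ ∑ x ∈ B, |E x * E' x| := Finset.abs_sum_le_sum_abs _ _
      _ ≤ ∑ _x ∈ B, C₁ * Λ⁻¹ * (C₁ * Λ⁻¹) := Finset.sum_le_sum fun x _ => by
          rw [abs_mul]; exact mul_le_mul (hEb x) (hE'b x) (abs_nonneg _) (by positivity)
      _ = B.card * (C₁ * Λ⁻¹ * (C₁ * Λ⁻¹)) := by rw [Finset.sum_const, nsmul_eq_mul]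
      _ ≤ (2 * Λ) ^ d * (C₁ * Λ⁻¹ * (C₁ * Λ⁻¹)) := mul_le_mul_of_nonneg_right hcard (by positivity)
  -- expand the sum
  have hexp : ∑ x ∈ B, fracCov d L α 0 k x * fracCov d L α 0 (k + l) x =
      Λ ^ (α - d) * Λ' ^ (α - d) *
        ((∑ x ∈ B, c x * c' x) + (∑ x ∈ B, c x * E' x) + (∑ x ∈ B, E x * c' x) + ∑ x ∈ B, E x * E' x) := by
    rw [← Finset.sum_add_distrib, ← Finset.sum_add_distrib, ← Finset.sum_add_distrib, Finset.mul_sum]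
    refine Finset.sum_congr rfl fun x _ => ?_
    rw [hCk x, hCm x]
    ring
  -- powers: `Λ^{α-d}Λ'^{α-d}Λ^d = Λ^{2α-d}(L^l)^{α-d}`
  have hpow : Λ ^ (α - d) * Λ' ^ (α - d) * Λ ^ d = Λ ^ (2 * α - d) * (L ^ l) ^ (α - d) := by
    rw [hΛ'eq, Real.mul_rpow hΛ0.le (by positivity), show (2 * α - d : ℝ) = (α - d) + (α - d) + d by ring,
      Real.rpow_add hΛ0, Real.rpow_add hΛ0, Real.rpow_natCast]
    ring
  rw [hexp]
  have hmain : Λ ^ (α - d) * Λ' ^ (α - d) *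
      ((∑ x ∈ B, c x * c' x) + (∑ x ∈ B, c x * E' x) + (∑ x ∈ B, E x * c' x) + ∑ x ∈ B, E x * E' x) -
      Λ ^ (2 * α - d) * (L ^ l) ^ (α - d) * innerC0 d L α l =
      Λ ^ (α - d) * Λ' ^ (α - d) *
        ((∑ x ∈ B, c x * c' x - Λ ^ d * innerC0 d L α l) + (∑ x ∈ B, c x * E' x) +
          (∑ x ∈ B, E x * c' x) + ∑ x ∈ B, E x * E' x) := by
    rw [← hpow]; ring
  rw [hmain, abs_mul, abs_of_pos (mul_pos hpk hpk')]
  -- total error `≤ [K4^d + 2^d(2C₀C₁ + C₁²)] Λ^{d-1}`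
  have hΛinv : Λ⁻¹ ≤ 1 := inv_le_one_of_one_le₀ hΛ1
  have herr : |(∑ x ∈ B, c x * c' x - Λ ^ d * innerC0 d L α l) + (∑ x ∈ B, c x * E' x) +
      (∑ x ∈ B, E x * c' x) + ∑ x ∈ B, E x * E' x| ≤
      (K * 4 ^ d + 2 ^ d * (2 * C₀ * C₁ + C₁ * C₁) + 1) * (Λ ^ d * Λ⁻¹) := by
    have h2d : (2 * Λ) ^ d = 2 ^ d * Λ ^ d := mul_pow _ _ _
    calc |(∑ x ∈ B, c x * c' x - Λ ^ d * innerC0 d L α l) + (∑ x ∈ B, c x * E' x) +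
          (∑ x ∈ B, E x * c' x) + ∑ x ∈ B, E x * E' x|
        ≤ |∑ x ∈ B, c x * c' x - Λ ^ d * innerC0 d L α l| + |∑ x ∈ B, c x * E' x| +
            |∑ x ∈ B, E x * c' x| + |∑ x ∈ B, E x * E' x| := by
          refine (abs_add_le _ _).trans (add_le_add ((abs_add_le _ _).trans (add_le_add (abs_add_le _ _) le_rfl)) le_rfl)
      _ ≤ K * 4 ^ d * Λ⁻¹ * Λ ^ d + (2 * Λ) ^ d * (C₀ * (C₁ * Λ⁻¹)) + (2 * Λ) ^ d * (C₁ * Λ⁻¹ * C₀) +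
            (2 * Λ) ^ d * (C₁ * Λ⁻¹ * (C₁ * Λ⁻¹)) := add_le_add (add_le_add (add_le_add hR' hX1) hX2) hX3
      _ = (K * 4 ^ d + 2 ^ d * (2 * C₀ * C₁ + C₁ * C₁ * Λ⁻¹)) * (Λ ^ d * Λ⁻¹) := by rw [h2d]; ring
      _ ≤ (K * 4 ^ d + 2 ^ d * (2 * C₀ * C₁ + C₁ * C₁) + 1) * (Λ ^ d * Λ⁻¹) := by
          apply mul_le_mul_of_nonneg_right _ (by positivity)
          have : C₁ * C₁ * Λ⁻¹ ≤ C₁ * C₁ := mul_le_of_le_one_right (by positivity) hΛinv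
          nlinarith [pow_pos (by norm_num : (0 : ℝ) < 2) d]
  calc Λ ^ (α - d) * Λ' ^ (α - d) * |(∑ x ∈ B, c x * c' x - Λ ^ d * innerC0 d L α l) +
        (∑ x ∈ B, c x * E' x) + (∑ x ∈ B, E x * c' x) + ∑ x ∈ B, E x * E' x|
      ≤ Λ ^ (α - d) * Λ' ^ (α - d) * ((K * 4 ^ d + 2 ^ d * (2 * C₀ * C₁ + C₁ * C₁) + 1) * (Λ ^ d * Λ⁻¹)) :=
        mul_le_mul_of_nonneg_left herr (mul_pos hpk hpk').le
    _ = (K * 4 ^ d + 2 ^ d * (2 * C₀ * C₁ + C₁ * C₁) + 1) * (Λ ^ (α - d) * Λ' ^ (α - d) * Λ ^ d) * Λ⁻¹ := by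
        ring
    _ = (K * 4 ^ d + 2 ^ d * (2 * C₀ * C₁ + C₁ * C₁) + 1) * Λ ^ (2 * α - d) * (L ^ l) ^ (α - d) * Λ⁻¹ := by
        rw [hpow]; ring

/-! ### Positivity of `⟨c₀, c_l⟩` -/

/-- **`I_l ≥ 0` for every `l`** (hence `⟨c₀,c_l⟩ ≥ 0`): `(L^k)^{d-2α}(L^l)^{d-α}(C_k,C_{k+l}) ≥ 0` for
all `k ≥ 2` (`FRD.sum_fracCov_mul_fracCov_nonneg`) converges to `I_l` by (10.45).
[cite: Slade2017, Lemma 5.2.2 (proof, §10.4: "each inner product … is nonnegative")] -/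
theorem innerC0_nonneg (hd : 1 ≤ d) {α : ℝ} (hα0 : 0 < α) (hα2 : α < 2) {L : ℝ} (hL : 2 ≤ L) (l : ℕ) :
    0 ≤ innerC0 d L α l := by
  have hL1 : (1 : ℝ) ≤ L := by linarith
  have hL0 : (0 : ℝ) < L := by linarith
  obtain ⟨C, hC, hA⟩ := sum_fracCov_mul_fracCov_asymp hd hα0 hα2 hL
  -- `I_l ≥ -C (L^k)⁻¹` for every `k ≥ 2`
  have hk : ∀ k : ℕ, 2 ≤ k → -(C * (L ^ k)⁻¹) ≤ innerC0 d L α l := by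
    intro k hk
    have hΛ0 : (0 : ℝ) < L ^ k := pow_pos hL0 k
    have h := hA k hk l
    -- the lattice sum is nonnegative
    have hpos : 0 ≤ ∑ x ∈ PT.ball (L ^ k / 2), fracCov d L α 0 k x * fracCov d L α 0 (k + l) x := by
      have hR1 : L ^ k / 2 < L ^ (k + l) / 2 + 1 := by
        have : L ^ k ≤ L ^ (k + l) := pow_le_pow_right₀ hL1 (by omega)
        linarith
      have hR2 : L ^ (k + l) / 2 < L ^ (k + l) / 2 + 1 := by linarith
      rw [← sum_fracCov_mul_eq_sum_ball hd hL1 α 0 (k + l) (le_refl (L ^ k / 2)) (PT.ball (L ^ (k + l) / 2 + 1))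
        (fun x hx => PT.mem_ball.2 (lt_trans (PT.mem_ball.1 hx) hR1))]
      exact sum_fracCov_mul_fracCov_nonneg hd hα0 hα2 hL hk (by omega) 0 hR1 hR2
    have hp1 : 0 < (L ^ k) ^ (2 * α - d) := Real.rpow_pos_of_pos hΛ0 _
    have hp2 : 0 < (L ^ l) ^ (α - d) := Real.rpow_pos_of_pos (pow_pos hL0 l) _
    have h2 := (abs_le.1 h).2
    -- `P (I + C Λ⁻¹) ≥ Σ ≥ 0` with `P > 0`
    have h3 : 0 ≤ (L ^ k) ^ (2 * α - d) * (L ^ l) ^ (α - d) * (innerC0 d L α l + C * (L ^ k)⁻¹) := by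
      have e : (L ^ k) ^ (2 * α - d) * (L ^ l) ^ (α - d) * (innerC0 d L α l + C * (L ^ k)⁻¹) =
          (L ^ k) ^ (2 * α - d) * (L ^ l) ^ (α - d) * innerC0 d L α l +
            C * (L ^ k) ^ (2 * α - d) * (L ^ l) ^ (α - d) * (L ^ k)⁻¹ := by ring
      rw [e]
      linarith
    have h4 := (mul_nonneg_iff_of_pos_left (mul_pos hp1 hp2)).1 h3
    linarith
  by_contra hneg
  push Not at hneg
  have hLinv : L⁻¹ < 1 := inv_lt_one_of_one_lt₀ (by linarith)
  obtain ⟨n, hn⟩ := exists_pow_lt_of_lt_one (div_pos (neg_pos.2 hneg) hC) hLinv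
  have h := hk (n + 2) (by omega)
  have hmono : L⁻¹ ^ (n + 2) ≤ L⁻¹ ^ n := pow_le_pow_of_le_one (by positivity) hLinv.le (by omega)
  rw [← inv_pow] at h
  have : C * L⁻¹ ^ (n + 2) < -innerC0 d L α l := by
    calc C * L⁻¹ ^ (n + 2) ≤ C * L⁻¹ ^ n := mul_le_mul_of_nonneg_left hmono hC.le
      _ < C * (-innerC0 d L α l / C) := mul_lt_mul_of_pos_left hn hC
      _ = -innerC0 d L α l := by field_simp
  linarith

end FRD

end LongRangePhi4

end Literature.Barriers.CriticalPhenomena
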